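import Literature.AlgebraicGeometry.Motives.PrymVariety
import Literature.AlgebraicGeometry.Motives.AbelianVarietyEquivariantSchur
import HarnessLib

/-!
# The induced action on the identity component of a kernel; Schur's lemma with operators (kernel half)

Sequel of `Motives/AbelianVarietyImageRestrict` (induced action on an IMAGE) and
`Motives/AbelianVarietyEquivariantSchur` (a non-zero equivariant homomorphism INTO an `R`-simple
abelian variety is surjective).  Over an algebraically closed field `K` the tree has the identity
component of a kernel as an abelian subvariety, `(Ker f)⁰_red = AbelianVariety.kerComponent f ↪ X`
(`Motives/PrymVariety`, with `kerComponentRestrict`: endomorphisms `u` of `X`, `v` of `Y` with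
`u ≫ f = f ≫ v` restrict to `(Ker f)⁰_red`, and the dimension formula
`dim X = dim Y + dim (Ker f)⁰_red` for surjective `f`).  Hence, for ring actions
`φ : R →+* End X`, `ψ : R →+* End Y` making `f : X ⟶ Y` equivariant:

* `AbelianVariety.kerComponentAction f φ ψ hf : R →+* End (kerComponent f)` — **the induced
  action on `(Ker f)⁰_red`**, with `kerComponentι f` equivariant (`kerComponentAction_ι`); so the
  identity component of the kernel of an equivariant homomorphism is an `R`-STABLE abelian
  subvariety;
* `AbelianVariety.isIsogeny_toImage_of_simpleFor` — **a non-zero equivariant homomorphism OUT OF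
  an `R`-simple abelian variety has finite kernel**: `X ↠ im f` is an isogeny (the `R`-stable
  `(Ker)⁰_red ↪ X` has dimension `< dim X`, hence `0`);
* `AbelianVariety.isIsogeny_of_simpleFor_of_simpleFor` — **Schur's lemma with operators**: a
  non-zero equivariant homomorphism between `R`-simple abelian varieties over an algebraically
  closed field is an ISOGENY (surjective by `surjective_of_simpleFor`, finite kernel by the above);
  `AbelianVariety.dim_eq_of_simpleFor_of_simpleFor` — in particular their dimensions agree.

(`R`-simple: no abelian variety `W` with `R`-action and equivariant closed immersion `W ↪ X` of
dimension `0 < dim W < dim X`; written out, binders explicit.  Mumford §19 Cor. 2 of Thm. 1 is the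
case of the trivial action; Lange–Rodríguez §2.9 the case of a finite group.)  The `def` is a
construction with a body; everything else is proved; no named fact (D-0026).

## References

* D. Mumford, *Abelian Varieties* (1970), §19 Thm. 1 and Cor. 2 (pp. 173–174). [MumfordAV1970]
* H. Lange, R. E. Rodríguez, *Decomposition of Jacobians by Prym Varieties*, LNM 2310 (2022),
  §2.9 and §3.2.1 (`(Ker)⁰` as an abelian subvariety stable under compatible correspondences).
  [LangeRodriguez2022]
-/

noncomputable section

universe u v

open CategoryTheory CategoryTheory.Limits AlgebraicGeometry

namespace Literature.AlgebraicGeometry.Motives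

namespace AbelianVariety

variable {K : Type u} [Field K] [IsAlgClosed K] {R : Type v} [Semiring R] {X Y : AbelianVariety K}
  (f : X ⟶ Y) (φ : R →+* End X) (ψ : R →+* End Y)
  (hf : ∀ r : R, End.asHom (φ r) ≫ f = f ≫ End.asHom (ψ r))

/-! ### The induced action on `(Ker f)⁰_red` -/

/-- **The induced action on the identity component of the kernel**: for ring actions
`φ : R →+* End X`, `ψ : R →+* End Y` making `f : X ⟶ Y` equivariant, the action
`R →+* End (Ker f)⁰_red` by restriction of `φ` (`kerComponentRestrict`).
[cite: LangeRodriguez2022, §3.2.1 and §2.9] [cite: MumfordAV1970, §19 Thm. 1 (p. 173)] -/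
def kerComponentAction : R →+* End (kerComponent f) where
  toFun r := kerComponentRestrict f (End.asHom (φ r)) (End.asHom (ψ r)) (hf r)
  map_one' := by
    have e : kerComponentRestrict f (End.asHom (φ 1)) (End.asHom (ψ 1)) (hf 1) =
        kerComponentRestrict f (𝟙 X) (𝟙 Y) (by rw [Category.id_comp, Category.comp_id]) := by
      congr 1 <;> rw [map_one] <;> rfl
    exact e.trans (kerComponentRestrict_id f)
  map_mul' r s := by
    have e : kerComponentRestrict f (End.asHom (φ (r * s))) (End.asHom (ψ (r * s))) (hf (r * s)) =
        kerComponentRestrict f (End.asHom (φ s) ≫ End.asHom (φ r))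
          (End.asHom (ψ s) ≫ End.asHom (ψ r))
          (by rw [Category.assoc, hf r, ← Category.assoc, hf s, Category.assoc]) := by
      congr 1 <;> rw [map_mul] <;> rfl
    exact e.trans (kerComponentRestrict_comp f _ _ _ _ (hf s) (hf r))
  map_zero' := by
    change kerComponentRestrict f (End.asHom (φ 0)) (End.asHom (ψ 0)) (hf 0) = 0
    rw [← cancel_mono (kerComponentι f), kerComponentRestrict_ι, map_zero, zero_comp]
    exact comp_zero
  map_add' r s := by
    have e : kerComponentRestrict f (End.asHom (φ (r + s))) (End.asHom (ψ (r + s))) (hf (r + s)) =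
        kerComponentRestrict f (End.asHom (φ r) + End.asHom (φ s))
          (End.asHom (ψ r) + End.asHom (ψ s))
          (by rw [Preadditive.add_comp, Preadditive.comp_add, hf r, hf s]) := by
      congr 1 <;> rw [map_add] <;> rfl
    exact e.trans (kerComponentRestrict_add f _ _ _ _ (hf r) (hf s))

/-- The inclusion `(Ker f)⁰_red ↪ X` is equivariant for the induced action.
[cite: LangeRodriguez2022, §3.2.1 and §2.9] -/
theorem kerComponentAction_ι (r : R) :
    End.asHom (kerComponentAction f φ ψ hf r) ≫ kerComponentι f =
      kerComponentι f ≫ End.asHom (φ r) :=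
  kerComponentRestrict_ι f _ _ (hf r)

/-! ### Schur's lemma with operators: the kernel half -/

include ψ hf in
/-- **A non-zero equivariant homomorphism out of an `R`-simple abelian variety has finite kernel**:
if `X` (with action `φ`) is `R`-simple and `f : X ⟶ Y` is equivariant and non-zero, then
`X ↠ im f` is an isogeny — the `R`-stable abelian subvariety `(Ker (X ↠ im f))⁰_red ↪ X`
(`kerComponentAction` for the induced action `imageAction` on `im f`) has dimension `< dim X`
(`dim_kerComponent_lt`), hence `0` by `R`-simplicity, and `dim X = dim (im f) + dim (Ker)⁰_red`.
[cite: MumfordAV1970, §19 Cor. 2 of Thm. 1] [cite: LangeRodriguez2022, §2.9] -/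
theorem isIsogeny_toImage_of_simpleFor
    (hX : ∀ (W : AbelianVariety K) (ω : R →+* End W) (w : W ⟶ X),
      IsClosedImmersion (Hom.toSchemeHom w) →
      (∀ r : R, w ≫ End.asHom (φ r) = End.asHom (ω r) ≫ w) → 0 < W.dim → W.dim < X.dim → False)
    (hf0 : f ≠ 0) : IsIsogeny (toImage f) := by
  have ht : ∀ r : R, End.asHom (φ r) ≫ toImage f =
      toImage f ≫ End.asHom (imageAction f φ ψ hf r) := fun r ↦ (toImage_imageAction f φ ψ hf r).symm
  have ht0 : toImage f ≠ 0 := fun h ↦ hf0 (by rw [← toImage_imageι f, h, zero_comp])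
  refine isIsogeny_of_surjective_of_dim_eq (toImage f) ?_
  have hd := dim_eq_dim_add_dim_kerComponent (toImage f)
  have hlt := dim_kerComponent_lt (toImage f) ht0
  by_contra hne
  exact hX (kerComponent (toImage f)) (kerComponentAction (toImage f) φ _ ht)
    (kerComponentι (toImage f)) inferInstance
    (fun r ↦ (kerComponentAction_ι (toImage f) φ _ ht r).symm) (by omega) hlt

include hf in
/-- **Schur's lemma with operators (isogeny form).** A non-zero equivariant homomorphism
`f : X ⟶ Y` between `R`-simple abelian varieties over an algebraically closed field is an isogeny:
it is surjective (`surjective_of_simpleFor`, the image half) and `(Ker f)⁰_red ↪ X` is an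
`R`-stable abelian subvariety of dimension `< dim X`, hence `0` (the kernel half), so
`dim X = dim Y`. [cite: MumfordAV1970, §19 Cor. 2 of Thm. 1] [cite: LangeRodriguez2022, §2.9] -/
theorem isIsogeny_of_simpleFor_of_simpleFor
    (hX : ∀ (W : AbelianVariety K) (ω : R →+* End W) (w : W ⟶ X),
      IsClosedImmersion (Hom.toSchemeHom w) →
      (∀ r : R, w ≫ End.asHom (φ r) = End.asHom (ω r) ≫ w) → 0 < W.dim → W.dim < X.dim → False)
    (hY : ∀ (W : AbelianVariety K) (ω : R →+* End W) (w : W ⟶ Y),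
      IsClosedImmersion (Hom.toSchemeHom w) →
      (∀ r : R, w ≫ End.asHom (ψ r) = End.asHom (ω r) ≫ w) → 0 < W.dim → W.dim < Y.dim → False)
    (hf0 : f ≠ 0) : IsIsogeny f := by
  haveI := surjective_of_simpleFor φ ψ f hf hY hf0
  refine isIsogeny_of_surjective_of_dim_eq f ?_
  have hd := dim_eq_dim_add_dim_kerComponent f
  have hlt := dim_kerComponent_lt f hf0
  by_contra hne
  exact hX (kerComponent f) (kerComponentAction f φ ψ hf) (kerComponentι f) inferInstance
    (fun r ↦ (kerComponentAction_ι f φ ψ hf r).symm) (by omega) hlt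

include hf in
/-- `R`-simple abelian varieties over an algebraically closed field linked by a non-zero
equivariant homomorphism have the same dimension. [cite: MumfordAV1970, §19 Cor. 2 of Thm. 1] -/
theorem dim_eq_of_simpleFor_of_simpleFor
    (hX : ∀ (W : AbelianVariety K) (ω : R →+* End W) (w : W ⟶ X),
      IsClosedImmersion (Hom.toSchemeHom w) →
      (∀ r : R, w ≫ End.asHom (φ r) = End.asHom (ω r) ≫ w) → 0 < W.dim → W.dim < X.dim → False)
    (hY : ∀ (W : AbelianVariety K) (ω : R →+* End W) (w : W ⟶ Y),
      IsClosedImmersion (Hom.toSchemeHom w) →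
      (∀ r : R, w ≫ End.asHom (ψ r) = End.asHom (ω r) ≫ w) → 0 < W.dim → W.dim < Y.dim → False)
    (hf0 : f ≠ 0) : X.dim = Y.dim :=
  dim_eq_of_isIsogeny (isIsogeny_of_simpleFor_of_simpleFor f φ ψ hf hX hY hf0)

end AbelianVariety

end Literature.AlgebraicGeometry.Motives

end
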